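import Summits.Schanuel.Schanuel.Theses.RoyCriterion

/-!
# Schanuel / RoyCriterion — `Assembly2` (item `stmt-Schanuel-0464`): the typed assembly

Route `Schanuel/RoyCriterion`, assembly item `stmt-Schanuel-0464` (`roy_assembly_typed`; route
declaration `Summit.Schanuel.Schanuel.Theses.RoyCriterion.Assembly2`, which unfolds to
`Roy2001_iff → (∀ n, RoyCriterion n) → Schanuel`): Roy's equivalence, rank by rank
(`Literature.NumberTheory.Transcendental.Roy2001_iff : ∀ l, RoyCriterion l ↔ SchanuelRank l`;
Roy 2001, Acta Arith. 97, §1 + Thm 1 + §5), taken as a hypothesis, together with Roy's arithmetic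
criterion (Conjecture 2) for every rank, gives Schanuel's conjecture.

This is pure bookkeeping: `Schanuel` unfolds to `Literature.Periods.SchanuelConjecture`, i.e. to
`∀ l, SchanuelRank l` verbatim (`Literature.Transcend.schanuel_iff_forall_schanuelRank`, `Iff.rfl`),
so the term is `fun h hR n => (h n).mp (hR n)` (in tree since p3322 as
`Literature.Transcend.roy2001_iff_imp_royCriterion_imp_schanuel`,
`Theorems/RoyCriterionAssembly.lean`). Here it is proved self-containedly (only the route file is
imported) against the route declaration BY NAME, which is what closes the ledger item. The
exact-signature twin `Assembly` (item `stmt-Schanuel-0079`) is closed by the same term.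

Not here: any mathematics of the route — the equivalence itself is the tree theorem
`Literature.NumberTheory.Transcendental.Roy2001_iff_holds` (item `RoyEquivalence`), and the content
of the line is the target `RoyThesisTyped` with the small-value cruxes below it.
-/

-- single-conjunct summit: `Summit.Schanuel.Schanuel.…` is the mandated namespace (CONVENTIONS §1, D-0017)
set_option linter.dupNamespace false

/-! ## Record of the dropped duplicate route decl `Assembly2`

REPAIR 2026-08-16 (fullbuild breakage "36:39: Unknown identifier
`Summit.Schanuel.Schanuel.Theses.RoyCriterion.Assembly2`", dependency drift). The gate's LINT AUTOFIX of
2026-08-16T14:15:59Z dropped the duplicate assembly item `Assembly2` (stmt-Schanuel-0464, the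
exact-signature twin of `Assembly` = stmt-Schanuel-0079, which was kept) from route `RoyCriterion`, so
the gate-written `Theses/RoyCriterion.lean` no longer declares the constant while this Theorems file —
append-only, statement text fixed — names it in the header of `royCriterion_assembly2_proof`. As in
`Summits/FinalStateConjecture/…/Theorems/SwallowTheDatumTargetGlue.lean`,
`Summits/ABC/ABC/Theorems/IsogenyGlueCongruencePolyFreyMazurPairs.lean` (p132079) and
`Summits/KontsevichZagierPeriods/…/GpcZeta4Eq4zeta31/Negative/Core.lean` (p132586), the dropped
constant is re-declared here under its original fully-qualified name with its original definiens (the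
ledger signature of stmt-Schanuel-0464, verbatim; byte-identical to the kept `Theses.RoyCriterion.Assembly`),
solely so that the landed proof record keeps elaborating; the landed theorem below is byte-identical.
It is NOT a route item and nothing takes it as a hypothesis. -/

namespace Summit.Schanuel.Schanuel.Theses.RoyCriterion

/-- **Record of the dropped route decl `Assembly2`** = stmt-Schanuel-0464 (`roy_assembly_typed`;
ledger signature verbatim, in the route file's namespace; dropped from the route by the gate's lint
autofix of 2026-08-16T14:15:59Z as the duplicate of `Assembly`, stmt-Schanuel-0079): Roy's equivalence
`∀ l, RoyCriterion l ↔ SchanuelRank l` (as the hypothesis `Roy2001_iff`) together with Roy's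
criterion for every rank gives the summit statement `Schanuel`. TRUE — proved below
(`Theorems.royCriterion_assembly2_proof`), and definitionally the kept route decl
`Theses.RoyCriterion.Assembly`. (Record of a route declaration, not a literature fact: deliberately
untagged so that the gate does not relocate it; source of the mathematics: Roy 2001, Acta Arith. 97,
§1 and Thm 1.) -/
def Assembly2 : Prop :=
  Literature.NumberTheory.Transcendental.Roy2001_iff → (∀ n, Literature.NumberTheory.Transcendental.RoyCriterion n) → Schanuel

end Summit.Schanuel.Schanuel.Theses.RoyCriterion

namespace Summit.Schanuel.Schanuel.Theorems

/-- Settles `stmt-Schanuel-0464` (assembly of route `RoyCriterion`): the route declaration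
`Summit.Schanuel.Schanuel.Theses.RoyCriterion.Assembly2` holds — Roy's equivalence
`∀ l, RoyCriterion l ↔ SchanuelRank l` (Roy 2001, §1 + Thm 1, as the hypothesis `Roy2001_iff`) and
Roy's criterion for every rank give Schanuel's conjecture, since `Schanuel` is definitionally
`∀ l, SchanuelRank l`: rank by rank, `(h n).mp (hR n)`. [folklore] -/
theorem royCriterion_assembly2_proof : Summit.Schanuel.Schanuel.Theses.RoyCriterion.Assembly2 := by
  unfold Summit.Schanuel.Schanuel.Theses.RoyCriterion.Assembly2
  intro h hR n
  exact (h n).mp (hR n)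

end Summit.Schanuel.Schanuel.Theorems
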